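import Literature.RepresentationTheory.MoeglinVignerasWaldspurger1987.RankOneThetaAnisotropicPlaneDichotomy
import HarnessLib

/-!
# The anisotropic-plane dichotomy read through an ARBITRARY centre line `J′` (the consumer's `z ↦ z·1` from `U(J′)(F_v)`)

Topic `RepresentationTheory/MoeglinVignerasWaldspurger1987`; namespace `Literature.RepresentationTheory.MoeglinVignerasWaldspurger1987` (sequel of ★
`RankOneThetaAnisotropicPlaneDichotomy`).  THEOREMS ONLY; cell hodgecm-mathlib, fan B rung B-IV; `--supports stmt-HodgeConjecture-24832`.

★ `rankOne_theta_anisotropicPlane_dichotomy(_of_eq)` reads the centre of `U(J)(F_v)` through the FIRST LINE `J₁` of the plane (`z ↦ z·1`,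
`U(J₁)(F_v) → U(J)(F_v)`).  A consumer — e.g. the rank-2 CM θ-package of [Liu2021, §D.1], whose centre character lives on `U(J_W)(F_v)` for the dual
line `J_W = (a′)` — reads it through ANOTHER rank-one hermitian line `J′` (`J′₀₀ ≠ 0`).  All these tori are the same `E_v¹`:

* `localCenter_one_comp` — `(z ↦ z·1_J) = (z ↦ z·1_J) ∘ (z ↦ z·1_{J₁})` as maps `U(J′) → U(J₁) → U(J)` (rank-one centre maps compose; their underlying
  families are all `z`), and `localCenter_one_one_inverse` — `U(J′) → U(J₁) → U(J′)` is the identity;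
* **`rankOne_theta_anisotropicPlane_dichotomy_centre`** — the dichotomy with the centre embedded from any `J′`: `∃ χ₀ : U(J′)(F_v) →* ℂˣ` with open
  kernel such that for every unitary continuous `χ` of `U(J′)(F_v)`, `Coinv_χ(ω_s ∘ (z ↦ z·1)) ≠ 0 ⟺ χ ≠ χ₀` (transport of characters and coinvariants
  along the isomorphism `U(J′) ≅ U(J₁)`, ★ `TwistedCoinv.ker_comp_mulEquiv`).

HC_CM is proved only modulo the printed citations — the 2 remaining named inputs (hLiu418 = stmt-HodgeConjecture-24832, h413 = 24833) — until rung 0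
closes; count-neutral.

## References
* [MoeglinVignerasWaldspurger1987] LNM 1291 (1987), Chap. 3 §IV.2, §IV.4 Théorème principal.
* [Mok2014] C. P. Mok, Mem. AMS 235 (2015), §1 Notation p. 5 (the centre `z ↦ z·1`).
* [Liu2021] Y. Liu, Camb. J. Math. 9 (2021), App. D §D.1 Step 3, Lem. D.1 (1).
-/

set_option autoImplicit false

noncomputable section

open NumberField IsDedekindDomain
open scoped TensorProduct Matrix
open Literature.RepresentationTheory.HeisenbergGroup
open Literature.RepresentationTheory.TwistedCoinv
open Literature.NumberTheory.GelbartRogawski1991.UnitaryDualPair.LocalSplitting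
open Literature.NumberTheory.GelbartRogawski1991.UnitaryDualPair.LocalSplitting.BlockSum
open Literature.NumberTheory.Automorphic
open Literature.NumberTheory.Automorphic.Liu2021
open Literature.NumberTheory.QuadraticForms

namespace Literature.RepresentationTheory.MoeglinVignerasWaldspurger1987

/-! ## §1 Rank-one centre maps compose and invert -/

section CentreMaps

variable {F : Type} [Field F] [NumberField F] (E : Type) [Field E] [NumberField E] [Algebra F E]
  (c : E ≃ₐ[F] E) (N : ℕ) (J : Matrix (Fin N) (Fin N) E) (J₁ J' : Matrix (Fin 1) (Fin 1) E)
  (hJ₁0 : J₁ 0 0 ≠ 0) (hJ'0 : J' 0 0 ≠ 0) (v : HeightOneSpectrum (𝓞 F))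

/-- the underlying family of the rank-one centre map `U(J′) → U(J₁)` is that of `z` (rank-one scalar matrices ARE the matrix).
[cite: Mok2014, §1 Notation p. 5] -/
theorem coe_localCenter_one_one (z : UnitaryGroup.localPi E c 1 J' v) :
    ((UnitaryGroup.localCenter E c 1 J₁ J' hJ'0 v z : UnitaryGroup.localPi E c 1 J₁ v) : UnitaryGroup.LocalGLPi E 1 v) =
      (z : UnitaryGroup.LocalGLPi E 1 v) := by
  rw [UnitaryGroup.coe_localCenter]
  -- `localScalarGL E 1 v z = z`: the family computed in ★ `localCenter_one_apply` (read at `J′`, `J′`)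
  have h := congrArg (fun x : UnitaryGroup.localPi E c 1 J' v => (x : UnitaryGroup.LocalGLPi E 1 v))
    (UnitaryGroup.localCenter_one_apply E c J' hJ'0 v z)
  simpa only [UnitaryGroup.coe_localCenter] using h

/-- **rank-one centre maps compose**: `U(J′) → U(J)` equals `U(J′) → U(J₁) → U(J)`. [cite: Mok2014, §1 Notation p. 5] -/
theorem localCenter_one_comp :
    UnitaryGroup.localCenter E c N J J' hJ'0 v =
      (UnitaryGroup.localCenter E c N J J₁ hJ₁0 v).comp (UnitaryGroup.localCenter E c 1 J₁ J' hJ'0 v) := by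
  refine MonoidHom.ext fun z => Subtype.ext ?_
  rw [MonoidHom.comp_apply, UnitaryGroup.coe_localCenter, UnitaryGroup.coe_localCenter, coe_localCenter_one_one E c J₁ J' hJ'0 v z]

/-- `U(J′) → U(J₁) → U(J′)` is the identity. [cite: Mok2014, §1 Notation p. 5] -/
theorem localCenter_one_one_inverse (z : UnitaryGroup.localPi E c 1 J' v) :
    UnitaryGroup.localCenter E c 1 J' J₁ hJ₁0 v (UnitaryGroup.localCenter E c 1 J₁ J' hJ'0 v z) = z :=
  Subtype.ext (by rw [coe_localCenter_one_one E c J' J₁ hJ₁0 v, coe_localCenter_one_one E c J₁ J' hJ'0 v])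

end CentreMaps

/-! ## §2 The dichotomy read through an arbitrary centre line -/

section Plane

variable (F : Type) [Field F] [NumberField F] (E : Type) [Field E] [NumberField E] [Algebra F E]
  [Algebra.IsQuadraticExtension F E] (c : E ≃ₐ[F] E) {δ : E} (hcδ : c δ = -δ) (hδ : δ ≠ 0) {d : F}
  (hd : δ * δ = algebraMap F E d) (v : HeightOneSpectrum (𝓞 F))
  {T₁ T₂ : Matrix (Fin 1) (Fin 1) F} (hT₁ : T₁.IsSymm) (hT₂ : T₂.IsSymm) (hT₁d : IsUnit T₁.det) (hT₂d : IsUnit T₂.det)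
  (a : Fˣ) (hTT' : T₂ = (a : F) • T₁)
  {J₁ J₂ : Matrix (Fin 1) (Fin 1) E} (hJ₁ : J₁ = T₁.map (algebraMap F E)) (hJ₂ : J₂ = T₂.map (algebraMap F E))
  {T : Matrix (Fin (1 + 1)) (Fin (1 + 1)) F} (hT : T = UnitaryGroup.finSum 1 1 T₁ T₂) (hTs : T.IsSymm)
  {J : Matrix (Fin (1 + 1)) (Fin (1 + 1)) E} (hJ : J = T.map (algebraMap F E))
  (s : UnitaryGroup.localPi E c (1 + 1) J v →* LocalMp F (1 + 1) T v)
  (hs : ∀ g, MpPsi.proj _ (s g) = iota F E c (1 + 1) hcδ hδ hd T hTs hJ v g)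
  (hJ₁0 : J₁ 0 0 ≠ 0) {J' : Matrix (Fin 1) (Fin 1) E} (hJ'0 : J' 0 0 ≠ 0) (hE : IsField (UnitaryGroup.LocalRing E v))

include hT₁ hT₂ hT₁d hT₂d a hTT' hJ₁ hJ₂ hT hJ hs hJ₁0 hE in
-- block-currency terms + the transport of coinvariants along the centre isomorphism: 2× the default budget
set_option maxHeartbeats 400000 in
/-- **The anisotropic-plane dichotomy, centre embedded from an arbitrary rank-one line `J′`.**  For the plane `T = T₁ ⊕ a•T₁` (`hT`) over the local
FIELD `E_v` with `(−a⁻¹, d)_v = −1`, a smooth section `s` over `ι_v` on `U(J)(F_v)` and any hermitian line `J′` with `J′₀₀ ≠ 0`, there is a character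
`χ₀` of `U(J′)(F_v) = E_v¹` with open kernel such that for every unitary continuous `χ` of `U(J′)(F_v)`:
`Coinv_χ(ω_s ∘ (z ↦ z·1_J)) ≠ 0 ⟺ χ ≠ χ₀`.  (★ `rankOne_theta_anisotropicPlane_dichotomy_of_eq` on `J₁`, transported along `U(J′) ≅ U(J₁)`.)
[cite: MoeglinVignerasWaldspurger1987, Chap. 3 §IV.4 Théorème principal; §IV.2] [cite: Liu2021, App. D Lemma D.1 (1) (p. 125, l. 5229)] -/
theorem rankOne_theta_anisotropicPlane_dichotomy_centre
    (hsm : Representation.IsSmooth ((MpPsi.toRep (localSchrodinger F (1 + 1) T v)).comp s))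
    (hclass : hilbertSymbol (v.adicCompletion F) ((-(a : F)⁻¹ : F) : v.adicCompletion F) ((d : F) : v.adicCompletion F) = -1) :
    ∃ χ₀ : UnitaryGroup.localPi E c 1 J' v →* ℂˣ, IsOpen (χ₀.ker : Set (UnitaryGroup.localPi E c 1 J' v)) ∧
      ∀ χ : UnitaryGroup.localPi E c 1 J' v →* ℂˣ, (∀ u, ‖((χ u : ℂˣ) : ℂ)‖ = 1) → (Continuous fun u => ((χ u : ℂˣ) : ℂ)) →
        (Nontrivial (Coinv
            (((MpPsi.toRep (localSchrodinger F (1 + 1) T v)).comp s).comp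
              (UnitaryGroup.localCenter E c (1 + 1) J J' hJ'0 v)) χ) ↔ χ ≠ χ₀) := by
  obtain ⟨χ₀, hχ₀o, hmain⟩ := rankOne_theta_anisotropicPlane_dichotomy_of_eq F E c hcδ hδ hd v hT₁ hT₂ hT₁d hT₂d a hTT' hJ₁ hJ₂ hT hTs
    hJ s hs hJ₁0 hE hsm hclass
  -- the centre isomorphism `e : U(J′) ≃* U(J₁)` (both `z ↦ z`)
  let e : UnitaryGroup.localPi E c 1 J' v ≃* UnitaryGroup.localPi E c 1 J₁ v :=
    { toFun := UnitaryGroup.localCenter E c 1 J₁ J' hJ'0 v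
      invFun := UnitaryGroup.localCenter E c 1 J' J₁ hJ₁0 v
      left_inv := fun z => localCenter_one_one_inverse E c J₁ J' hJ₁0 hJ'0 v z
      right_inv := fun z => localCenter_one_one_inverse E c J' J₁ hJ'0 hJ₁0 v z
      map_mul' := map_mul _ }
  have he : ∀ z, e z = UnitaryGroup.localCenter E c 1 J₁ J' hJ'0 v z := fun _ => rfl
  have hecont : Continuous e := UnitaryGroup.continuous_localCenter E c 1 J₁ J' hJ'0 v
  have hesymmcont : Continuous e.symm := UnitaryGroup.continuous_localCenter E c 1 J' J₁ hJ₁0 v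
  refine ⟨χ₀.comp e.toMonoidHom, hχ₀o.preimage hecont, fun χ hχu hχc => ?_⟩
  -- `χ = χ₁ ∘ e` with `χ₁ := χ ∘ e⁻¹` a unitary continuous character of `U(J₁)`
  have hχ₁u : ∀ u, ‖(((χ.comp e.symm.toMonoidHom) u : ℂˣ) : ℂ)‖ = 1 := fun u => hχu _
  have hχ₁c : Continuous fun u => (((χ.comp e.symm.toMonoidHom) u : ℂˣ) : ℂ) := hχc.comp hesymmcont
  have hχe : χ = (χ.comp e.symm.toMonoidHom).comp e.toMonoidHom := by
    refine MonoidHom.ext fun z => ?_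
    rw [MonoidHom.comp_apply, MonoidHom.comp_apply, MulEquiv.coe_toMonoidHom, MulEquiv.coe_toMonoidHom, MulEquiv.symm_apply_apply]
  -- the coinvariants through `J′` are those through `J₁` re-indexed along `e`
  have hcZ : UnitaryGroup.localCenter E c (1 + 1) J J' hJ'0 v =
      (UnitaryGroup.localCenter E c (1 + 1) J J₁ hJ₁0 v).comp e.toMonoidHom :=
    localCenter_one_comp E c (1 + 1) J J₁ J' hJ₁0 hJ'0 v
  have hiff := hmain (χ.comp e.symm.toMonoidHom) hχ₁u hχ₁c
  have hker : ker ((((MpPsi.toRep (localSchrodinger F (1 + 1) T v)).comp s).comp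
        (UnitaryGroup.localCenter E c (1 + 1) J J₁ hJ₁0 v)).comp e.toMonoidHom)
        ((χ.comp e.symm.toMonoidHom).comp e.toMonoidHom) =
      ker (((MpPsi.toRep (localSchrodinger F (1 + 1) T v)).comp s).comp (UnitaryGroup.localCenter E c (1 + 1) J J₁ hJ₁0 v))
        (χ.comp e.symm.toMonoidHom) :=
    ker_comp_mulEquiv _ _ e
  have hq : Nontrivial (Coinv (((MpPsi.toRep (localSchrodinger F (1 + 1) T v)).comp s).comp
        (UnitaryGroup.localCenter E c (1 + 1) J J' hJ'0 v)) χ) ↔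
      Nontrivial (Coinv (((MpPsi.toRep (localSchrodinger F (1 + 1) T v)).comp s).comp
        (UnitaryGroup.localCenter E c (1 + 1) J J₁ hJ₁0 v)) (χ.comp e.symm.toMonoidHom)) := by
    rw [hcZ]
    conv_lhs => rw [hχe]
    exact (Submodule.quotEquivOfEq _ _ hker).toEquiv.nontrivial_congr
  rw [hq, hiff, not_iff_not]
  constructor
  · intro h
    rw [← h]
    exact hχe
  · intro h
    rw [h]
    refine MonoidHom.ext fun z => ?_
    rw [MonoidHom.comp_apply, MonoidHom.comp_apply, MulEquiv.coe_toMonoidHom, MulEquiv.coe_toMonoidHom, MulEquiv.apply_symm_apply]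

end Plane

end Literature.RepresentationTheory.MoeglinVignerasWaldspurger1987

end
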